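import Literature.NumberTheory.EllipticCurves.FormalGroupQuasiPeriodCocycleFactorsProofs
import Literature.NumberTheory.EllipticCurves.FormalGroupQuasiPeriodAdditionProofs
import Literature.NumberTheory.EllipticCurves.FormalGroupChordFormulaUniversalProofs
import Literature.NumberTheory.EllipticCurves.FormalGroupDictionaryProofs
import HarnessLib

/-!
# The addition cocycle of the quasi-period function is INTEGRAL (Katz 1981 §5.1: `η₀` is a
# quasi-logarithm) — proofs only

Topic `Literature/NumberTheory/EllipticCurves`. Pure proof file. For a Weierstrass equation `W` over a domain
`R` and an injective homomorphism `φ : R →+* A` into a `ℚ`-algebra domain (`ℤ ↪ ℚ`, `ℤ_p ↪ ℚ_p`, `𝒪_F′ ↪ F′`,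
`ℤ[a₁,…,a₆] ↪ ℚ[a₁,…,a₆]`), the addition cocycle `C₀ = η₀(u +_F v) − η₀(u) − η₀(v) ∈ A⟦u, v⟧` of the quasi-period
function of `W ⊗ A` (`FormalGroupQuasiPeriod`) has coefficients in `R`:

  `exists_map_eq_formalQuasiPeriodCocycle : ∃ C : R⟦u, v⟧, map φ C = C₀(W ⊗ A)`,

i.e. `η₀` is a quasi-logarithm in the sense of Katz (`dη₀ = g_W dz` integral — `FormalGroupQuasiPeriod` — and
`η₀(X +_F Y) − η₀(X) − η₀(Y)` integral), representing the class of the differential of the second kind `x ω` in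
the Dieudonné module `D(Ŵ/R)`. Proof: exact division. The pseudo-addition theorem
(`formalQuasiPeriodCocycle_mul_eq_of_chord` + the universal chord formula `formalXMulSq_formalGroupLaw_chord'`)
writes `M′·C₀ = N′` with `N′` integral and `M′ = u·v·N·F = u·v·(v−u)·(v−i(u))²·U_N·U_F`
(`FormalGroupQuasiPeriodCocycleFactorsProofs`: `U_N`, `U_F` integral units); each linear factor divides the
current integral numerator because the quotient identity, restricted to the factor's zero locus (`u = 0`, `v = 0`,
`v = u`, `v = i(u)`) and pulled back along the injective `φ`, says the numerator vanishes there (factor theorem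
along a curve, `X_one_sub_dvd_of_subst_eq_zero`); finally one multiplies by `(U_N U_F)⁻¹ ∈ R⟦u, v⟧`.

BSD context: crux K★ `stmt-BirchSwinnertonDyer-22226`, hDR sector (iii): with `C₀` integral, the `η`-period
`∫_t η = lim pⁿ η₀(ûₙ)` is Cauchy in `B_dR⁺/Fil^m` (`pⁿ·C₀(û, [k]û) → 0`). BSD is not proved by any of this.

## References
* N. M. Katz, *Crystalline cohomology, Dieudonné modules, and Jacobi sums* (1981), §5.1 (`D(G/R)`: `f` with `df`
  and `f(X +_G Y) − f(X) − f(Y)` integral). [Katz1981CrystallineDieudonne]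
* J. H. Silverman, *The Arithmetic of Elliptic Curves* (2009), III.2.3, IV.1. [SilvermanAEC2009]
-/

noncomputable section

open PowerSeries Literature.NumberTheory.EllipticCurves

namespace WeierstrassCurve

section Integral

variable {R A : Type*} [CommRing R] [CommRing A] {φ : R →+* A}

/-- Restriction to `u = 0` commutes with base change. [cite: SilvermanAEC2009, IV.1.1] -/
private theorem map_subst_zero_X (P : MvPowerSeries (Fin 2) R) :
    PowerSeries.map φ (MvPowerSeries.subst ![(0 : R⟦X⟧), PowerSeries.X] P) =
      MvPowerSeries.subst ![(0 : A⟦X⟧), PowerSeries.X] (MvPowerSeries.map φ P) := by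
  have h := MvPowerSeries.map_subst (hasSubst_zero_X (R := R)) (h := φ) P
  have hfam : (fun i => MvPowerSeries.map φ ((![(0 : R⟦X⟧), PowerSeries.X]) i)) = ![(0 : A⟦X⟧), PowerSeries.X] := by
    funext i; fin_cases i
    · exact map_zero _
    · exact PowerSeries.map_X φ
  rw [hfam] at h
  exact h

/-- Restriction to a curve `v = a(u)` commutes with base change. [cite: SilvermanAEC2009, IV.1.1] -/
private theorem map_subst_X_powerSeries (a : R⟦X⟧) (ha : constantCoeff a = 0) (P : MvPowerSeries (Fin 2) R) :
    PowerSeries.map φ (MvPowerSeries.subst ![(PowerSeries.X : R⟦X⟧), a] P) =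
      MvPowerSeries.subst ![(PowerSeries.X : A⟦X⟧), PowerSeries.map φ a] (MvPowerSeries.map φ P) := by
  have h := MvPowerSeries.map_subst (hasSubst_X_powerSeries ha) (h := φ) P
  have hfam : (fun i => MvPowerSeries.map φ ((![(PowerSeries.X : R⟦X⟧), a]) i)) =
      ![(PowerSeries.X : A⟦X⟧), PowerSeries.map φ a] := by
    funext i; fin_cases i
    · exact PowerSeries.map_X φ
    · rfl
  rw [hfam] at h
  exact h

/-- One exact-division step: if `f ∣ P` in `R⟦u,v⟧` and `φ(P) = φ(f)·D` with `φ(f) ≠ 0`, then `D = φ(P/f)`.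
[cite: Katz1981CrystallineDieudonne, §5.1] -/
private theorem div_step [IsDomain A] {f P : MvPowerSeries (Fin 2) R} {D : MvPowerSeries (Fin 2) A} (hfP : f ∣ P)
    (h : MvPowerSeries.map φ P = MvPowerSeries.map φ f * D) (hf : MvPowerSeries.map φ f ≠ 0) :
    ∃ P' : MvPowerSeries (Fin 2) R, MvPowerSeries.map φ P' = D := by
  obtain ⟨P', rfl⟩ := hfP
  refine ⟨P', mul_left_cancel₀ hf ?_⟩
  rw [← map_mul]
  exact h

variable (hφ : Function.Injective φ)
include hφ

/-- Pull back `P(0, v) = 0` along `φ`: `X₀ ∣ P`. [cite: SilvermanAEC2009, IV.1.1] -/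
private theorem X_zero_dvd_of_map {P : MvPowerSeries (Fin 2) R}
    (h : MvPowerSeries.subst ![(0 : A⟦X⟧), PowerSeries.X] (MvPowerSeries.map φ P) = 0) :
    (MvPowerSeries.X 0 : MvPowerSeries (Fin 2) R) ∣ P := by
  refine X_zero_dvd_of_subst_zero_X_eq_zero (mvPowerSeries_map_injective (σ := Unit) hφ ?_)
  rw [show MvPowerSeries.map (σ := Unit) φ (MvPowerSeries.subst ![(0 : R⟦X⟧), PowerSeries.X] P) =
    PowerSeries.map φ (MvPowerSeries.subst ![(0 : R⟦X⟧), PowerSeries.X] P) from rfl, map_subst_zero_X, h]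
  exact (map_zero _).symm

/-- Pull back `P(u, a(u)) = 0` along `φ`: `(X₁ − a(X₀)) ∣ P`. [cite: SilvermanAEC2009, IV.1.1] -/
private theorem X_one_sub_dvd_of_map {a : R⟦X⟧} (ha : constantCoeff a = 0) {P : MvPowerSeries (Fin 2) R}
    (h : MvPowerSeries.subst ![(PowerSeries.X : A⟦X⟧), PowerSeries.map φ a] (MvPowerSeries.map φ P) = 0) :
    (MvPowerSeries.X 1 - a.subst (MvPowerSeries.X 0 : MvPowerSeries (Fin 2) R)) ∣ P := by
  refine X_one_sub_dvd_of_subst_eq_zero ha (mvPowerSeries_map_injective (σ := Unit) hφ ?_)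
  rw [show MvPowerSeries.map (σ := Unit) φ (MvPowerSeries.subst ![(PowerSeries.X : R⟦X⟧), a] P) =
    PowerSeries.map φ (MvPowerSeries.subst ![(PowerSeries.X : R⟦X⟧), a] P) from rfl, map_subst_X_powerSeries a ha, h]
  exact (map_zero _).symm

variable [IsDomain R] [IsDomain A] [Algebra ℚ A] (W : WeierstrassCurve R)

/-- **The addition cocycle of the quasi-period function is integral**: for a Weierstrass equation `W` over a
domain `R` and an injective `φ : R →+* A` into a `ℚ`-algebra domain, `C₀(W ⊗ A) = η₀(u +_F v) − η₀(u) − η₀(v)`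
is the image of a series with coefficients in `R` — `η₀` is a quasi-logarithm (Katz). [cite: Katz1981CrystallineDieudonne, §5.1] -/
theorem exists_map_eq_formalQuasiPeriodCocycle :
    ∃ C : MvPowerSeries (Fin 2) R, MvPowerSeries.map φ C = (W.map φ).formalQuasiPeriodCocycle := by
  haveI : CharZero A := charZero_of_injective_algebraMap (algebraMap ℚ A).injective
  have h2 : (2 : R) ≠ 0 := fun h => by
    have h' := congrArg φ h
    rw [map_ofNat, map_zero] at h'
    exact two_ne_zero h'
  have hs := hasSubst_zero_X (R := A)
  -- the factorisations over `R`
  obtain ⟨UN, hN, hUN⟩ := W.chordN_eq_mul_mul h2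
  obtain ⟨UF, hF, hUF⟩ := W.formalGroupLaw_eq_mul
  -- base change of the pieces
  have hXu : MvPowerSeries.map φ (W.formalXMulSq.subst (MvPowerSeries.X 0 : MvPowerSeries (Fin 2) R)) = (W.map φ).formalXMulSq.subst (MvPowerSeries.X 0 : MvPowerSeries (Fin 2) A) := by
    rw [PowerSeries.map_subst (PowerSeries.HasSubst.X 0), map_formalXMulSq, MvPowerSeries.map_X]
  have hXv : MvPowerSeries.map φ (W.formalXMulSq.subst (MvPowerSeries.X 1 : MvPowerSeries (Fin 2) R)) = (W.map φ).formalXMulSq.subst (MvPowerSeries.X 1 : MvPowerSeries (Fin 2) A) := by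
    rw [PowerSeries.map_subst (PowerSeries.HasSubst.X 1), map_formalXMulSq, MvPowerSeries.map_X]
  have hc : MvPowerSeries.map φ (W.formalNeg.subst (MvPowerSeries.X 0 : MvPowerSeries (Fin 2) R)) = (W.map φ).formalNeg.subst (MvPowerSeries.X 0 : MvPowerSeries (Fin 2) A) := by
    rw [PowerSeries.map_subst (PowerSeries.HasSubst.X 0), map_formalNeg, MvPowerSeries.map_X]
  have hFmap : MvPowerSeries.map φ W.formalGroupLaw = (W.map φ).formalGroupLaw := map_formalGroupLaw W φ
  have hi : PowerSeries.map φ W.formalNeg = (W.map φ).formalNeg := map_formalNeg W φ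
  -- the pseudo-addition theorem for `W ⊗ A`
  have hmain := (W.map φ).formalQuasiPeriodCocycle_mul_eq_of_chord (W.map φ).formalXMulSq_formalGroupLaw_chord'
  set C₀ := (W.map φ).formalQuasiPeriodCocycle with hC₀
  -- non-vanishing in the domain `A⟦u, v⟧`
  have hX0 : (MvPowerSeries.X 0 : MvPowerSeries (Fin 2) A) ≠ 0 := fun h => by
    have := congrArg (MvPowerSeries.coeff (Finsupp.single (0 : Fin 2) 1)) h
    rw [MvPowerSeries.coeff_X, if_pos rfl, map_zero] at this
    exact one_ne_zero this
  have hne_of_subst : ∀ {g : MvPowerSeries (Fin 2) A},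
      MvPowerSeries.subst ![(0 : A⟦X⟧), PowerSeries.X] g ≠ 0 → g ≠ 0 := by
    intro g hg h0
    exact hg (by rw [h0, ← MvPowerSeries.coe_substAlgHom hs, map_zero])
  have hX1 : (MvPowerSeries.X 1 : MvPowerSeries (Fin 2) A) ≠ 0 :=
    hne_of_subst (by rw [subst_zero_X_X_one]; exact PowerSeries.X_ne_zero)
  have hX10 : (MvPowerSeries.X 1 - MvPowerSeries.X 0 : MvPowerSeries (Fin 2) A) ≠ 0 :=
    hne_of_subst (by rw [MvPowerSeries.subst_sub hs, subst_zero_X_X_one, subst_zero_X_X_zero, sub_zero]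
                     exact PowerSeries.X_ne_zero)
  have hX1c : (MvPowerSeries.X 1 - (W.map φ).formalNeg.subst (MvPowerSeries.X 0 : MvPowerSeries (Fin 2) A)) ≠ 0 :=
    hne_of_subst (by
      rw [MvPowerSeries.subst_sub hs, subst_zero_X_X_one, subst_zero_X_powerSeries_subst_X_zero,
        constantCoeff_formalNeg, map_zero, sub_zero]
      exact PowerSeries.X_ne_zero)
  -- restriction values used repeatedly
  have hcA : MvPowerSeries.subst ![(PowerSeries.X : A⟦X⟧), (W.map φ).formalNeg] ((W.map φ).formalNeg.subst (MvPowerSeries.X 0 : MvPowerSeries (Fin 2) A)) = (W.map φ).formalNeg := by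
    have hXa := hasSubst_X_powerSeries (W.map φ).constantCoeff_formalNeg
    rw [mvSubst_powerSeries_subst (PowerSeries.HasSubst.X 0) hXa, MvPowerSeries.subst_X hXa]
    exact PowerSeries.X_subst _
  -- Step 1: `u ∣ N′`
  have hN0 : MvPowerSeries.subst ![(0 : A⟦X⟧), PowerSeries.X] (MvPowerSeries.map φ (((MvPowerSeries.X 0 : MvPowerSeries (Fin 2) R) * MvPowerSeries.X 1 *
          (W.formalXMulSq.subst (MvPowerSeries.X 0 : MvPowerSeries (Fin 2) R) * (MvPowerSeries.X 1) ^ 2 -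
          W.formalXMulSq.subst (MvPowerSeries.X 1 : MvPowerSeries (Fin 2) R) * (MvPowerSeries.X 0) ^ 2) -
        (MvPowerSeries.X 0 + MvPowerSeries.X 1) *
          (W.formalXMulSq.subst (MvPowerSeries.X 0 : MvPowerSeries (Fin 2) R) * (MvPowerSeries.X 1) ^ 2 -
          W.formalXMulSq.subst (MvPowerSeries.X 1 : MvPowerSeries (Fin 2) R) * (MvPowerSeries.X 0) ^ 2) * W.formalGroupLaw -
        (W.formalXMulSq.subst (MvPowerSeries.X 1 : MvPowerSeries (Fin 2) R) * (MvPowerSeries.X 0) ^ 3 -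
            W.formalXMulSq.subst (MvPowerSeries.X 0 : MvPowerSeries (Fin 2) R) * (MvPowerSeries.X 1) ^ 3) * W.formalGroupLaw))) = 0 := by
    rw [map_sub, map_sub, map_mul, map_mul, map_mul, map_mul, map_mul, map_sub, map_mul, map_mul, map_sub,
      map_mul, map_mul, map_add, map_pow, map_pow, map_pow, map_pow, hXu, hXv, hFmap, MvPowerSeries.map_X,
      MvPowerSeries.map_X]
    simp only [MvPowerSeries.subst_sub hs, MvPowerSeries.subst_mul hs, MvPowerSeries.subst_add hs,
      MvPowerSeries.subst_pow hs, subst_zero_X_X_zero, subst_zero_X_X_one, subst_zero_X_powerSeries_subst_X_zero,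
      subst_zero_X_powerSeries_subst_X_one, constantCoeff_formalXMulSq, map_one, (W.map φ).formalGroupLaw_subst_zero_X]
    ring
  have hmap0 : MvPowerSeries.map φ (((MvPowerSeries.X 0 : MvPowerSeries (Fin 2) R) * MvPowerSeries.X 1 *
          (W.formalXMulSq.subst (MvPowerSeries.X 0 : MvPowerSeries (Fin 2) R) * (MvPowerSeries.X 1) ^ 2 -
          W.formalXMulSq.subst (MvPowerSeries.X 1 : MvPowerSeries (Fin 2) R) * (MvPowerSeries.X 0) ^ 2) -
        (MvPowerSeries.X 0 + MvPowerSeries.X 1) *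
          (W.formalXMulSq.subst (MvPowerSeries.X 0 : MvPowerSeries (Fin 2) R) * (MvPowerSeries.X 1) ^ 2 -
          W.formalXMulSq.subst (MvPowerSeries.X 1 : MvPowerSeries (Fin 2) R) * (MvPowerSeries.X 0) ^ 2) * W.formalGroupLaw -
        (W.formalXMulSq.subst (MvPowerSeries.X 1 : MvPowerSeries (Fin 2) R) * (MvPowerSeries.X 0) ^ 3 -
            W.formalXMulSq.subst (MvPowerSeries.X 0 : MvPowerSeries (Fin 2) R) * (MvPowerSeries.X 1) ^ 3) * W.formalGroupLaw)) =
      MvPowerSeries.map φ (MvPowerSeries.X 0 : MvPowerSeries (Fin 2) R) *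
        ((MvPowerSeries.X 1 : MvPowerSeries (Fin 2) A) * ((W.map φ).formalXMulSq.subst (MvPowerSeries.X 0 : MvPowerSeries (Fin 2) A) * (MvPowerSeries.X 1) ^ 2 -
          (W.map φ).formalXMulSq.subst (MvPowerSeries.X 1 : MvPowerSeries (Fin 2) A) * (MvPowerSeries.X 0) ^ 2) * (W.map φ).formalGroupLaw * C₀) := by
    rw [MvPowerSeries.map_X]
    rw [map_sub, map_sub, map_mul, map_mul, map_mul, map_mul, map_mul, map_sub, map_mul, map_mul, map_sub,
      map_mul, map_mul, map_add, map_pow, map_pow, map_pow, map_pow, hXu, hXv, hFmap, MvPowerSeries.map_X,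
      MvPowerSeries.map_X]
    linear_combination -hmain
  obtain ⟨P₁, hP₁⟩ := div_step (X_zero_dvd_of_map hφ hN0) hmap0 (by rw [MvPowerSeries.map_X]; exact hX0)
  -- Step 2: `v ∣ P₁`
  have hmap1 : MvPowerSeries.map φ P₁ = MvPowerSeries.map φ (MvPowerSeries.X 1 : MvPowerSeries (Fin 2) R) *
      (((W.map φ).formalXMulSq.subst (MvPowerSeries.X 0 : MvPowerSeries (Fin 2) A) * (MvPowerSeries.X 1) ^ 2 -
          (W.map φ).formalXMulSq.subst (MvPowerSeries.X 1 : MvPowerSeries (Fin 2) A) * (MvPowerSeries.X 0) ^ 2) * (W.map φ).formalGroupLaw * C₀) := by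
    rw [hP₁, MvPowerSeries.map_X]; ring
  have hP₁0 : MvPowerSeries.subst ![(PowerSeries.X : A⟦X⟧), PowerSeries.map φ 0] (MvPowerSeries.map φ P₁) = 0 := by
    have hX0s : MvPowerSeries.HasSubst ![(PowerSeries.X : A⟦X⟧), 0] := hasSubst_X_powerSeries (map_zero _)
    rw [map_zero, hmap1, MvPowerSeries.map_X, MvPowerSeries.subst_mul hX0s, MvPowerSeries.subst_X hX0s]
    exact zero_mul _
  have hdvd1 := X_one_sub_dvd_of_map hφ (map_zero _) hP₁0
  rw [show (0 : R⟦X⟧).subst (MvPowerSeries.X 0 : MvPowerSeries (Fin 2) R) = 0 by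
    rw [← PowerSeries.coe_substAlgHom (PowerSeries.HasSubst.X 0), map_zero], sub_zero] at hdvd1
  obtain ⟨P₂, hP₂⟩ := div_step hdvd1 hmap1 (by rw [MvPowerSeries.map_X]; exact hX1)
  -- Step 3: `(v − u) ∣ P₂`
  have hNtA : ((W.map φ).formalXMulSq.subst (MvPowerSeries.X 0 : MvPowerSeries (Fin 2) A) * (MvPowerSeries.X 1) ^ 2 -
          (W.map φ).formalXMulSq.subst (MvPowerSeries.X 1 : MvPowerSeries (Fin 2) A) * (MvPowerSeries.X 0) ^ 2) =
      (MvPowerSeries.X 1 - MvPowerSeries.X 0) * ((MvPowerSeries.X 1 - (W.map φ).formalNeg.subst (MvPowerSeries.X 0 : MvPowerSeries (Fin 2) A)) * MvPowerSeries.map φ UN) := by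
    have h := congrArg (MvPowerSeries.map φ) hN
    rw [map_sub, map_mul, map_mul, map_pow, map_pow, hXu, hXv, MvPowerSeries.map_X, MvPowerSeries.map_X, map_mul,
      map_mul, map_sub, map_sub, MvPowerSeries.map_X, MvPowerSeries.map_X, hc] at h
    exact h
  have hmap2 : MvPowerSeries.map φ P₂ =
      MvPowerSeries.map φ (MvPowerSeries.X 1 - (PowerSeries.X : R⟦X⟧).subst (MvPowerSeries.X 0 : MvPowerSeries (Fin 2) R)) *
        ((MvPowerSeries.X 1 - (W.map φ).formalNeg.subst (MvPowerSeries.X 0 : MvPowerSeries (Fin 2) A)) * MvPowerSeries.map φ UN * (W.map φ).formalGroupLaw * C₀) := by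
    rw [hP₂, hNtA, PowerSeries.subst_X (PowerSeries.HasSubst.X 0), map_sub, MvPowerSeries.map_X, MvPowerSeries.map_X]
    ring
  have hP₂0 : MvPowerSeries.subst ![(PowerSeries.X : A⟦X⟧), PowerSeries.map φ PowerSeries.X]
      (MvPowerSeries.map φ P₂) = 0 := by
    have hXX : MvPowerSeries.HasSubst ![(PowerSeries.X : A⟦X⟧), PowerSeries.X] :=
      hasSubst_X_powerSeries PowerSeries.constantCoeff_X
    rw [PowerSeries.map_X, hmap2, PowerSeries.subst_X (PowerSeries.HasSubst.X 0), map_sub, MvPowerSeries.map_X,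
      MvPowerSeries.map_X, MvPowerSeries.subst_mul hXX, MvPowerSeries.subst_sub hXX, MvPowerSeries.subst_X hXX,
      MvPowerSeries.subst_X hXX]
    exact mul_eq_zero_of_left (sub_self _) _
  obtain ⟨P₃, hP₃⟩ := div_step (X_one_sub_dvd_of_map hφ PowerSeries.constantCoeff_X hP₂0) hmap2 (by
    rw [PowerSeries.subst_X (PowerSeries.HasSubst.X 0), map_sub, MvPowerSeries.map_X, MvPowerSeries.map_X]; exact hX10)
  -- Step 4: `(v − i(u)) ∣ P₃` (through `F`)
  have hFA : (W.map φ).formalGroupLaw = (MvPowerSeries.X 1 - (W.map φ).formalNeg.subst (MvPowerSeries.X 0 : MvPowerSeries (Fin 2) A)) * MvPowerSeries.map φ UF := by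
    have h := congrArg (MvPowerSeries.map φ) hF
    rw [hFmap, map_mul, map_sub, MvPowerSeries.map_X, hc] at h
    exact h
  have hmap3 : MvPowerSeries.map φ P₃ = MvPowerSeries.map φ (MvPowerSeries.X 1 - W.formalNeg.subst (MvPowerSeries.X 0 : MvPowerSeries (Fin 2) R)) *
      (MvPowerSeries.map φ UN * (MvPowerSeries.X 1 - (W.map φ).formalNeg.subst (MvPowerSeries.X 0 : MvPowerSeries (Fin 2) A)) * MvPowerSeries.map φ UF * C₀) := by
    rw [hP₃, hFA, map_sub, MvPowerSeries.map_X, hc]; ring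
  have hvan : ∀ {G : MvPowerSeries (Fin 2) A},
      MvPowerSeries.subst ![(PowerSeries.X : A⟦X⟧), PowerSeries.map φ W.formalNeg]
        (MvPowerSeries.map φ (MvPowerSeries.X 1 - W.formalNeg.subst (MvPowerSeries.X 0 : MvPowerSeries (Fin 2) R)) * G) = 0 := by
    intro G
    have hXa := hasSubst_X_powerSeries (W.map φ).constantCoeff_formalNeg
    rw [hi, map_sub, MvPowerSeries.map_X, hc, MvPowerSeries.subst_mul hXa, MvPowerSeries.subst_sub hXa,
      MvPowerSeries.subst_X hXa, hcA]
    exact mul_eq_zero_of_left (sub_self _) _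
  have hP₃0 := hvan (G := MvPowerSeries.map φ UN * (MvPowerSeries.X 1 - (W.map φ).formalNeg.subst (MvPowerSeries.X 0 : MvPowerSeries (Fin 2) A)) * MvPowerSeries.map φ UF * C₀)
  rw [← hmap3] at hP₃0
  obtain ⟨P₄, hP₄⟩ := div_step (X_one_sub_dvd_of_map hφ W.constantCoeff_formalNeg hP₃0) hmap3 (by
    rw [map_sub, MvPowerSeries.map_X, hc]; exact hX1c)
  -- Step 5: `(v − i(u)) ∣ P₄` (through `N`)
  have hmap4 : MvPowerSeries.map φ P₄ = MvPowerSeries.map φ (MvPowerSeries.X 1 - W.formalNeg.subst (MvPowerSeries.X 0 : MvPowerSeries (Fin 2) R)) *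
      (MvPowerSeries.map φ UN * MvPowerSeries.map φ UF * C₀) := by
    rw [hP₄, map_sub, MvPowerSeries.map_X, hc]; ring
  have hP₄0 := hvan (G := MvPowerSeries.map φ UN * MvPowerSeries.map φ UF * C₀)
  rw [← hmap4] at hP₄0
  obtain ⟨P₅, hP₅⟩ := div_step (X_one_sub_dvd_of_map hφ W.constantCoeff_formalNeg hP₄0) hmap4 (by
    rw [map_sub, MvPowerSeries.map_X, hc]; exact hX1c)
  -- Step 6: divide by the unit `U_N·U_F`
  have hU1 : MvPowerSeries.constantCoeff (UN * UF) = 1 := by rw [map_mul, hUN, hUF, mul_one]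
  refine ⟨MvPowerSeries.invOfUnit (UN * UF) 1 * P₅, ?_⟩
  rw [map_mul, mvPowerSeries_map_invOfUnit_one φ (UN * UF) hU1, hP₅, map_mul]
  have hU1' : MvPowerSeries.constantCoeff (MvPowerSeries.map φ UN * MvPowerSeries.map φ UF) = 1 := by
    rw [← map_mul, MvPowerSeries.constantCoeff_map, hU1, map_one]
  have hinv := MvPowerSeries.mul_invOfUnit (MvPowerSeries.map φ UN * MvPowerSeries.map φ UF) 1
    (by rw [hU1', Units.val_one])
  linear_combination C₀ * hinv

end Integral

end WeierstrassCurve
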